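import Summits.BirchSwinnertonDyer.Rank1Residual.Additive.CyclotomicTowerSignedLocalTransverse
import HarnessLib

/-!
# The PLUS and MINUS Kummer conditions are DISJOINT on `η`-odd points: an `η`-odd point
# `A ∈ E⁺(K_{n,v})` lies in `E⁻(K_{n,v}) + q^k·E(K_{n,v})` only if `A ∈ q^k·E⁺(K_{n,v})`
# (cell `bsd-potss`, seat `bsd-potss-ctrl` g2; the point-level core of the kernel route to the typed
# reading (L0⁺) `EvenBranchPlusLocalControlZeroAt` = Kobayashi's (9.33) at `n = 0`, TARGET.md v2
# §1.1 T-e2-r0; sibling of x1b's TRANSVERSALITY file `CyclotomicTowerSignedLocalTransverse.lean`)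

HONEST FRAMING (cell `bsd-potss`, run/shared/lean/pub/bsd-potss/; FULL-BSD rank ≤ 1 programme,
tranche 1b): TOOL THEOREMS ONLY (local algebra on Kobayashi's signed groups, generic tower) — no
definition, no named Literature fact, no Summits-side fact `def … : Prop`, no `sorry`, axioms
standard; the inputs Prop. 8.12 ii) (`hsum`, `hint`) and Prop. 8.7 (`htors`) are HYPOTHESES here,
KERNEL THEOREMS for the lane's curves (x1b GEN 33–34: `KobayashiSignedGenerationTower`,
`CyclotomicTowerSignedLocalIntersection`, `StrictSignedControlZeroExactLocal`); nothing is booked;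
no label / mark / count moves; nothing about (C1_η) or `BSD(W, p)` of any pair is claimed.

## Source (S. Kobayashi, Invent. Math. 152 (2003), held copy `paper:doi-10-1007-s00222-002-0265-4`)

§2 p. 4 (the groups `E^±(K_{n,v})`, `K_{−1} = ℚ`); Prop. 8.7 (p. 16: no `p`-power torsion over
`k_n`); Prop. 8.12 ii) (p. 17) with Def. 8.16 (p. 19): `Ê⁺(m_n) ∩ Ê⁻(m_n) = Ê(m_{−1})`,
`Ê(m_n) = Ê⁺(m_n) + Ê⁻(m_n)` — the exact sequence (8.22); Lemma 8.17 (p. 19: saturation). These give,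
on each component `η ≠ 1` of `Δ = Gal(ℚ_p(μ_p)/ℚ_p)` (`(Ê(m_{−1}))^η = 0`):
`(Ê⁺(m_n) ⊗ ℚ_p/ℤ_p)^η ∩ (Ê⁻(m_n) ⊗ ℚ_p/ℤ_p)^η = 0` inside `Ê(m_n) ⊗ ℚ_p/ℤ_p` — the "disjointness"
that, together with x1b's B3 count (`H¹(ℚ_p, W[p^m]) = 𝓚 ⊕ Σ⁻`, replacing Kobayashi's Thm. 6.2),
yields (9.33) for the sign `+` at `n = 0`: the level-`∞` PLUS Kummer condition pulls back to the
classical one. This file is the POINT-LEVEL form of that disjointness for the quadratic character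
(`η`-odd points: `τ • A = −A`), in the generic currency of x1b's transversality file.

## What is proved (generic: any field `K`, any antitone tower `U` of finite index with normal layers,
## any model `E`, any embedding `ι`, any curve `W`, any odd `q : ℕ` and power `q^k`)

* §1 `exists_eq_pow_nsmul_of_plus_eq_minus_add` — **DISJOINTNESS**: under Prop. 8.12 ii) at layer `n`
  (`hsum`, `hint`) and no `q`-torsion in `E(K_{n,v})` (`htors`), if `A ∈ E⁺(K_{n,v})` is `η`-odd
  (`τ • A = −A` for some `τ ∈ Γ_E`) and `A = M + q^k • Q` with `M ∈ E⁻(K_{n,v})`, `Q ∈ E(K_{n,v})`,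
  then `A = q^k • A'` for some `A' ∈ E⁺(K_{n,v})` (and then `M = q^k • (A' − Q)` with
  `A' − Q ∈ E⁻(K_{n,v})` by saturation). Proof (the algebra of x1b's
  `exists_mem_zero_eq_nsmul_of_eq_add_nsmul`, with the bottom point replaced by a plus point): split
  `Q = Q⁺ + Q⁻`; `Z := A − q^k Q⁺ = M + q^k Q⁻ ∈ E⁺ ∩ E⁻ ≤ E(K_{−1,v})` is `τ`-fixed, whence
  `2A = q^k (Q⁺ − τQ⁺)`; `q^k = 2c + 1` gives `A = q^k • (A − c(Q⁺ − τQ⁺))`, and Lemma 8.17 puts the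
  root in `E⁺`.
* §2 `eq_zero_of_plus_of_minus_of_smul_eq_neg` — the case `k`-free: an `η`-odd point in
  `E⁺(K_{n,v}) ∩ E⁻(K_{n,v})` is `2`-torsion, hence ZERO when `E(K_{n,v})` has no `2q`… — stated as:
  it is killed by `2` (`two_nsmul_eq_zero_of_plus_of_minus_of_smul_eq_neg`); and the Kummer-level
  corollary `exists_eq_pow_nsmul_and_of_plus_eq_minus_add` packaging both roots.

References: [Kobayashi2003] §2 p. 4, Prop. 8.7 (p. 16), Prop. 8.12 ii) (p. 17), Def. 8.16 and
Lemma 8.17 (p. 19), Prop. 9.2 / (9.33) (p. 26); [SerreGaloisCohomology1997] II.§1.1.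
-/

noncomputable section

open scoped Classical

universe u

namespace Summit.BirchSwinnertonDyer.Rank1Residual.Additive

open Literature.NumberTheory.EllipticCurves Literature.NumberTheory.GaloisRepresentations
  Literature.NumberTheory.EllipticCurves.Kobayashi2003 ZpExtension

section Disjoint

variable {K : Type u} [Field K] {E : Type u} [Field E] [Algebra K E]
  (U : ℕ → Subgroup (Field.absoluteGaloisGroup K)) [hU : ∀ n, (U n).FiniteIndex]
  (ι : AlgebraicClosure K →ₐ[K] AlgebraicClosure E) (W : WeierstrassCurve K)

/-- **An `η`-odd point of `E⁺(K_{n,v}) ∩ E⁻(K_{n,v})` is killed by `2`** (modulo Prop. 8.12 ii),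
first identity `hint`): it lies in `E(K_{−1,v})`, hence is `τ`-fixed, and `τ • Z = −Z`.
[cite: Kobayashi2003, Prop. 8.12 ii) (p. 17), Def. 8.16 (p. 19)] -/
theorem two_nsmul_eq_zero_of_plus_of_minus_of_smul_eq_neg (n : ℕ)
    (hint : towerSignedLocalPointsOfEmb U ι W 1 n ⊓ towerSignedLocalPointsOfEmb U ι W (-1) n ≤
      localFixedPointsOfEmb ι W ⊤)
    {Z : localPoints W E} (hZp : Z ∈ towerSignedLocalPointsOfEmb U ι W 1 n)
    (hZm : Z ∈ towerSignedLocalPointsOfEmb U ι W (-1) n)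
    {τ : Field.absoluteGaloisGroup E} (hτ : τ • Z = -Z) : (2 : ℕ) • Z = 0 := by
  have hZ : Z ∈ localFixedPointsOfEmb ι W ⊤ := hint (AddSubgroup.mem_inf.mpr ⟨hZp, hZm⟩)
  have hfix : τ • Z = Z := (mem_localFixedPointsOfEmb_top_iff ι W _).mp hZ τ
  rw [hfix] at hτ
  rw [two_nsmul]
  calc Z + Z = Z + -Z := by rw [← hτ]
    _ = 0 := add_neg_cancel Z

/-- **DISJOINTNESS of the plus and minus Kummer conditions on `η`-odd points (modulo Prop. 8.12 ii)).**
Tower `U` antitone with normal layers; HYPOTHESES: `hsum : E(K_{n,v}) ≤ E⁺(K_{n,v}) ⊔ E⁻(K_{n,v})`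
and `hint : E⁺(K_{n,v}) ⊓ E⁻(K_{n,v}) ≤ E(K_{−1,v})` (Prop. 8.12 ii) with Def. 8.16), `htors`: no point of
`E(K_{n,v})` is `q`-torsion (Prop. 8.7, `q = p`), `q` odd. If `A ∈ E⁺(K_{n,v})` is `η`-odd
(`τ • A = −A`) and `A = M + q^k • Q` with `M ∈ E⁻(K_{n,v})`, `Q ∈ E(K_{n,v})` — i.e. the Kummer class
`A ⊗ q^{−k}` of the PLUS group equals the Kummer class `M ⊗ q^{−k}` of the MINUS group — then
`A = q^k • A'` for some `A' ∈ E⁺(K_{n,v})`: the common class is ZERO. Proof: `Q = Q⁺ + Q⁻`;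
`Z := A − q^k Q⁺ = M + q^k Q⁻ ∈ E⁺ ∩ E⁻ ≤ E(K_{−1,v})` is `τ`-fixed, so `2A = q^k (Q⁺ − τ Q⁺)`; with
`q^k = 2c + 1`, `A = q^k A − c·2A = q^k • (A − c (Q⁺ − τQ⁺))`, and the root lies in `E⁺(K_{n,v})` by
Lemma 8.17 (`towerSignedLocalPointsOfEmb_saturated`). The `η ≠ 1` component of Kobayashi's
`Ê⁺(m_n) ∩ Ê⁻(m_n) = Ê(m_{−1})` read through ` ⊗ ℚ_p/ℤ_p`. [cite: Kobayashi2003, Prop. 8.12 ii) (p. 17), Def. 8.16 and Lemma 8.17 (p. 19), Prop. 8.7 (p. 16)] -/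
theorem exists_eq_pow_nsmul_of_plus_eq_minus_add (hUa : Antitone U) [hN : ∀ n, (U n).Normal] (n : ℕ)
    (hsum : localFixedPointsOfEmb ι W (U n) ≤
      towerSignedLocalPointsOfEmb U ι W 1 n ⊔ towerSignedLocalPointsOfEmb U ι W (-1) n)
    (hint : towerSignedLocalPointsOfEmb U ι W 1 n ⊓ towerSignedLocalPointsOfEmb U ι W (-1) n ≤
      localFixedPointsOfEmb ι W ⊤)
    {q : ℕ} (hq : Odd q) (k : ℕ) (htors : ∀ Q ∈ localFixedPointsOfEmb ι W (U n), q • Q = 0 → Q = 0)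
    {A : localPoints W E} (hA : A ∈ towerSignedLocalPointsOfEmb U ι W 1 n)
    {τ : Field.absoluteGaloisGroup E} (hτ : τ • A = -A)
    {M Q : localPoints W E} (hM : M ∈ towerSignedLocalPointsOfEmb U ι W (-1) n)
    (hQ : Q ∈ localFixedPointsOfEmb ι W (U n)) (hAMQ : A = M + q ^ k • Q) :
    ∃ A' ∈ towerSignedLocalPointsOfEmb U ι W 1 n, A = q ^ k • A' := by
  have hAn : A ∈ localFixedPointsOfEmb ι W (U n) := towerSignedLocalPointsOfEmb_le U ι W 1 n hA
  -- split `Q = Q⁺ + Q⁻` (Prop. 8.12 ii), second identity)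
  obtain ⟨Qp, hQp, Qm, hQm, hQsum⟩ := AddSubgroup.mem_sup.mp (hsum hQ)
  have hQpn : Qp ∈ localFixedPointsOfEmb ι W (U n) := towerSignedLocalPointsOfEmb_le U ι W 1 n hQp
  -- `Z = A - q^k • Q⁺ = M + q^k • Q⁻ ∈ E⁺ ⊓ E⁻ ≤ E(K_{-1,v})` (Prop. 8.12 ii), first identity)
  have hZ : A - q ^ k • Qp ∈ localFixedPointsOfEmb ι W ⊤ := by
    have h1 : A - q ^ k • Qp ∈ towerSignedLocalPointsOfEmb U ι W 1 n :=
      (towerSignedLocalPointsOfEmb U ι W 1 n).sub_mem hA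
        ((towerSignedLocalPointsOfEmb U ι W 1 n).nsmul_mem hQp (q ^ k))
    have h2 : A - q ^ k • Qp ∈ towerSignedLocalPointsOfEmb U ι W (-1) n := by
      have e : A - q ^ k • Qp = M + q ^ k • Qm := by rw [hAMQ, ← hQsum, smul_add]; abel
      rw [e]
      exact (towerSignedLocalPointsOfEmb U ι W (-1) n).add_mem hM
        ((towerSignedLocalPointsOfEmb U ι W (-1) n).nsmul_mem hQm (q ^ k))
    exact hint (AddSubgroup.mem_inf.mpr ⟨h1, h2⟩)
  -- `τ` fixes `Z`, hence `2A = q^k (Q⁺ - τQ⁺)`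
  have hτZ : τ • (A - q ^ k • Qp) = A - q ^ k • Qp := (mem_localFixedPointsOfEmb_top_iff ι W _).mp hZ τ
  rw [smul_sub, hτ, smul_comm] at hτZ
  -- hτZ : -A - q^k • τ • Qp = A - q^k • Qp
  have h2 : (2 : ℕ) • A = q ^ k • (Qp - τ • Qp) := by
    rw [smul_sub, two_nsmul]
    calc A + A = A + A + ((-A - q ^ k • τ • Qp) - (A - q ^ k • Qp)) := by rw [hτZ, sub_self, add_zero]
      _ = q ^ k • Qp - q ^ k • τ • Qp := by abel
  -- `q^k = 2c + 1`: `A = q^k • (A - c • (Q⁺ - τQ⁺))`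
  obtain ⟨c, hc⟩ := hq.pow (n := k)
  set R := Qp - τ • Qp with hR
  have hRn : R ∈ localFixedPointsOfEmb ι W (U n) :=
    sub_mem hQpn (smul_mem_localFixedPointsOfEmb ι W (U n) τ hQpn)
  have hSn : A - c • R ∈ localFixedPointsOfEmb ι W (U n) := sub_mem hAn (AddSubgroup.nsmul_mem _ hRn c)
  have hqS : q ^ k • (A - c • R) = A := by
    rw [smul_sub, smul_comm (q ^ k) c R, ← h2, ← mul_nsmul', hc]
    rw [add_nsmul, one_nsmul, mul_comm c 2, add_sub_cancel_left]
  refine ⟨A - c • R, ?_, hqS.symm⟩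
  -- the root is a plus point by saturation (Lemma 8.17), applied `q` at a time along `q^k`
  have hsat : ∀ (j : ℕ) (S : localPoints W E), S ∈ localFixedPointsOfEmb ι W (U n) →
      q ^ j • S ∈ towerSignedLocalPointsOfEmb U ι W 1 n → S ∈ towerSignedLocalPointsOfEmb U ι W 1 n := by
    intro j
    induction j with
    | zero => intro S _ h; simpa using h
    | succ j ih =>
      intro S hS h
      rw [pow_succ, mul_comm, mul_nsmul] at h
      have hqS' : q • S ∈ localFixedPointsOfEmb ι W (U n) := AddSubgroup.nsmul_mem _ hS q
      exact towerSignedLocalPointsOfEmb_saturated ι W U hUa 1 n htors hS (ih (q • S) hqS' h)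
  exact hsat k (A - c • R) hSn (by rw [hqS]; exact hA)

/-- **Kummer-level corollary.** Same hypotheses: if the plus class `A ⊗ q^{−k}` and the minus class
`M ⊗ q^{−k}` agree in `E(K_{n,v}) ⊗ ℤ/q^k` (`A = M + q^k • Q`), with `A` `η`-odd, then BOTH are zero
there: `A = q^k • A'` with `A' ∈ E⁺(K_{n,v})` and `M = q^k • M'` with `M' ∈ E⁻(K_{n,v})`
(`M' = A' − Q`, Lemma 8.17 for the sign `−`). [cite: Kobayashi2003, Prop. 8.12 ii) (p. 17), Lemma 8.17 (p. 19)] -/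
theorem exists_eq_pow_nsmul_and_of_plus_eq_minus_add (hUa : Antitone U) [hN : ∀ n, (U n).Normal] (n : ℕ)
    (hsum : localFixedPointsOfEmb ι W (U n) ≤
      towerSignedLocalPointsOfEmb U ι W 1 n ⊔ towerSignedLocalPointsOfEmb U ι W (-1) n)
    (hint : towerSignedLocalPointsOfEmb U ι W 1 n ⊓ towerSignedLocalPointsOfEmb U ι W (-1) n ≤
      localFixedPointsOfEmb ι W ⊤)
    {q : ℕ} (hq : Odd q) (k : ℕ) (htors : ∀ Q ∈ localFixedPointsOfEmb ι W (U n), q • Q = 0 → Q = 0)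
    {A : localPoints W E} (hA : A ∈ towerSignedLocalPointsOfEmb U ι W 1 n)
    {τ : Field.absoluteGaloisGroup E} (hτ : τ • A = -A)
    {M Q : localPoints W E} (hM : M ∈ towerSignedLocalPointsOfEmb U ι W (-1) n)
    (hQ : Q ∈ localFixedPointsOfEmb ι W (U n)) (hAMQ : A = M + q ^ k • Q) :
    ∃ A' ∈ towerSignedLocalPointsOfEmb U ι W 1 n, ∃ M' ∈ towerSignedLocalPointsOfEmb U ι W (-1) n,
      A = q ^ k • A' ∧ M = q ^ k • M' := by
  obtain ⟨A', hA', hAA'⟩ :=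
    exists_eq_pow_nsmul_of_plus_eq_minus_add U ι W hUa n hsum hint hq k htors hA hτ hM hQ hAMQ
  have hA'n : A' ∈ localFixedPointsOfEmb ι W (U n) := towerSignedLocalPointsOfEmb_le U ι W 1 n hA'
  have hM' : M = q ^ k • (A' - Q) := by
    rw [smul_sub, ← hAA', hAMQ, add_sub_cancel_right]
  refine ⟨A', hA', A' - Q, ?_, hAA', hM'⟩
  -- `A' - Q ∈ E⁻` by saturation along `q^k`
  have hsat : ∀ (j : ℕ) (S : localPoints W E), S ∈ localFixedPointsOfEmb ι W (U n) →
      q ^ j • S ∈ towerSignedLocalPointsOfEmb U ι W (-1) n → S ∈ towerSignedLocalPointsOfEmb U ι W (-1) n := by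
    intro j
    induction j with
    | zero => intro S _ h; simpa using h
    | succ j ih =>
      intro S hS h
      rw [pow_succ, mul_comm, mul_nsmul] at h
      have hqS' : q • S ∈ localFixedPointsOfEmb ι W (U n) := AddSubgroup.nsmul_mem _ hS q
      exact towerSignedLocalPointsOfEmb_saturated ι W U hUa (-1) n htors hS (ih (q • S) hqS' h)
  exact hsat k (A' - Q) (sub_mem hA'n hQ) (by rw [← hM']; exact hM)

end Disjoint

end Summit.BirchSwinnertonDyer.Rank1Residual.Additive

end
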